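import Mathlib
import HarnessLib
import Summits.QuantumFields.QCD.Theses.HeatSlicedQuarks

/-!
# Sketch — first lemmas of the crux ideas filed by ideator 2 (round 1) on
`InterleavedFlowProper` (stmt-QuantumFields-18031, route HeatSlicedQuarks)

Prop DEFINITIONS only (no proofs, no sorries): they are the `First lemma:` fields of the cards
`idea-decouple-before-binding.md` and `idea-finite-range-heat-slices.md`, checked to elaborate.
-/

namespace Summit.QuantumFields.QCD.Cruxes.InterleavedFlowProper.IdeaSketch2

open scoped BigOperators Matrix ComplexOrder
open Filter Topology
open Literature.MathematicalPhysics.QuantumFieldTheory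
open Literature.MathematicalPhysics.QuantumLattice
open Literature.Probability.LatticeModels
open Summit.QuantumFields.QCD.Theses.HeatSlicedQuarks

/-! ## Card `decouple-before-binding` -/

/-- The HEAVY CORNER of X₀: the same matrix as `ContinuumQCDExists`, but only for mass tuples
above a witness-chosen flavour-blind threshold `M₀`. -/
def ContinuumQCDExistsAbove : Prop :=
  ∀ Nf : ℕ, Nf = 2 ∨ Nf = 3 → ∃ M₀ : ℝ, 0 ≤ M₀ ∧ ∃ reg : QCDRegularisation Nf, reg.HasMassScaling ∧
    ∀ m : Fin Nf → ℝ, (∀ f, M₀ < m f) →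
      ∃ (z shift : QCDField Nf → ℕ → ℝ) (T : OSData (QCDField Nf) 4),
        IsQCDAlong (reg.scheme m z shift) T ∧ T.IsNontrivial QCDField.glue ∧
          T.IsNonGaussian QCDField.glue ∧
            ∀ f g : Fin Nf, f ≠ g → T.IsNontrivial (QCDField.pseudoRe f g)

/-- FIRST LEMMA (card `decouple-before-binding`, provable now): X₀ has no chirality clause, so the
flavour-blind additive offset of `m_crit` is free and the heavy corner is ADMISSIBLE — re-pin
`m_crit(k) ↦ m_crit(k) + a_k M₀ / Z_m(k)` (the bare trajectory of the tuple `m` in the re-pinned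
regularisation is the bare trajectory of `m + M₀` in the old one; `HasMassScaling` is untouched). -/
def HeavyCornerAdmissible : Prop :=
  ContinuumQCDExists ↔ ContinuumQCDExistsAbove

/-- The re-pinning map used in `HeavyCornerAdmissible` (data-level statement of the lever). -/
noncomputable def repin {Nf : ℕ} (reg : QCDRegularisation Nf) (M₀ : ℝ) : QCDRegularisation Nf where
  a := reg.a
  a_pos := reg.a_pos
  tendsto_a := reg.tendsto_a
  β := reg.β
  L := reg.L
  tendsto_L := reg.tendsto_L
  mcrit := fun k => reg.mcrit k + reg.a k * M₀ / reg.Zm k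
  Zm := reg.Zm
  Zm_pos := reg.Zm_pos

/-- The re-pinned scheme of the tuple `m` IS the old scheme of the shifted tuple `m + M₀`
(definitional bookkeeping behind `HeavyCornerAdmissible`). -/
def RepinScheme : Prop :=
  ∀ (Nf : ℕ) (reg : QCDRegularisation Nf) (M₀ : ℝ) (m : Fin Nf → ℝ) (z shift : QCDField Nf → ℕ → ℝ),
    (repin reg M₀).scheme m z shift = reg.scheme (fun f => m f + M₀) z shift

/-- WEAK WINDOW (card `decouple-before-binding`, provable now, real analysis on `afBeta`): along an
asymptotically scaling sequence the two-loop inverse coupling at every FERMION-ACTIVE scale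
`ℓ ∈ [a_k, 1/M₀]`, i.e. `afBeta Nf Λ ℓ`, is at least `β_*` once `M₀` is large — the fermionic RG of
the heavy corner never leaves weak coupling (`β = 2/g₀²` in the tree's normalisation). -/
def WeakWindow : Prop :=
  ∀ (Nf : ℕ), Nf = 2 ∨ Nf = 3 → ∀ (Λ βstar : ℝ), 0 < Λ → ∃ M₀ : ℝ, 0 < M₀ ∧
    ∀ ℓ : ℝ, 0 < ℓ → ℓ ≤ 1 / M₀ → βstar ≤ afBeta Nf Λ ℓ

/-! ## Card `finite-range-heat-slices` -/

/-- Index type of quark fields on the `L`-torus (site × colour × spin), as in the route file. -/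
abbrev Idx (L : ℕ) := TorusSite 4 L × Fin 3 × Fin 4

/-- `H_U = D_W(U,m,1)ᴴ D_W(U,m,1)` for `SU(3)` links, the engine's generator. -/
noncomputable def H (L : ℕ) [NeZero L]
    (U : GaugeConfig 4 L (Matrix.specialUnitaryGroup (Fin 3) ℂ)) (m : ℝ) : Matrix (Idx L) (Idx L) ℂ :=
  Matrix.conjTranspose (wilsonDirac (fundamentalRep (Fin 3)) U m 1) * wilsonDirac (fundamentalRep (Fin 3)) U m 1

/-- FIRST LEMMA (card `finite-range-heat-slices`): BAUERSCHMIDT'S WAVE-EQUATION DECOMPOSITION OF THE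
QUARK GREEN FORM. For every torus, every `SU(3)` field, every `m ∈ [−1/2, 1]` and every infrared
regulator `μ > 0`, the resolvent `(H_U + μ²)⁻¹` is a sum of POSITIVE SEMI-DEFINITE pieces `Φ n`,
piece `n` having EXACT finite range `2^(n+1)` in torus distance (it is a polynomial of degree
`≤ 2^n` in the range-2 operator `H_U`), and — this is where the engine enters — on every ball on
which the plaquettes are scale-covariantly small at scale `r ≥ 2^n` (the hypothesis of the PROVED
crux `SmallFieldUltracontractivity`, 8871) the diagonal of piece `n` has FREE size `C · 4^(−n)`
(Newtonian scaling `range^(−(d−2))`, `d = 4`), with `ε, K, C` independent of `L, U, m, μ`.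
Positivity makes every fermionic slice `Φ n · D_Wᴴ` a GRAM kernel for all `U`; finite range makes
fluctuation integrals over blocks farther than `2^(n+1)` apart factorise exactly.
[Bauerschmidt, PTRF 157 (2013), Thm 1.2 with condition (P*_{θ,B}) and (H_{α,ω}), α = 4;
arXiv:1206.2212] -/
def FiniteRangeHeatSlices : Prop :=
  ∃ ε : ℝ, 0 < ε ∧ ∃ K : ℕ, ∃ C : ℝ, ∀ (L : ℕ) [NeZero L]
    (U : GaugeConfig 4 L (Matrix.specialUnitaryGroup (Fin 3) ℂ)) (m : ℝ), m ∈ Set.Icc (-(1 / 2 : ℝ)) 1 →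
    ∀ μ : ℝ, 0 < μ →
      ∃ Φ : ℕ → Matrix (Idx L) (Idx L) ℂ,
        (∀ n, (Φ n).PosSemidef) ∧
        (∀ n (x y : Idx L), 2 ^ (n + 1) < torusDist x.1 y.1 → Φ n x y = 0) ∧
        HasSum Φ ((H L U m + ((μ : ℂ) ^ 2) • (1 : Matrix (Idx L) (Idx L) ℂ))⁻¹) ∧
        ∀ (n : ℕ) (x : TorusSite 4 L) (r : ℕ), 2 ^ n ≤ r → r ≤ L →
          (∀ y : TorusSite 4 L, torusDist x y ≤ K * r → ∀ μ' ν' : Fin 4,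
            3 - ((fundamentalRep (Fin 3)) (plaquetteHolonomy U y μ' ν')).trace.re ≤ (ε / (r : ℝ) ^ 2) ^ 2) →
          ∀ (a : Fin 3) (α : Fin 4), ‖Φ n (x, a, α) (x, a, α)‖ ≤ C / (4 : ℝ) ^ n

/-- CHEBYSHEV FINITE RANGE (the structural core of `FiniteRangeHeatSlices`, provable now): a
polynomial of degree `d` in a range-`R` operator has range `d • R`; here `H_U` has torus range 2
(two hops), so `p(H_U)` vanishes beyond distance `2 · natDegree p`. -/
def PolynomialFiniteRange : Prop :=
  ∀ (L : ℕ) [NeZero L] (U : GaugeConfig 4 L (Matrix.specialUnitaryGroup (Fin 3) ℂ)) (m : ℝ)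
    (p : Polynomial ℂ) (x y : Idx L),
    2 * p.natDegree < torusDist x.1 y.1 → (Polynomial.aeval (H L U m) p) x y = 0

end Summit.QuantumFields.QCD.Cruxes.InterleavedFlowProper.IdeaSketch2
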